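import Literature.MathematicalPhysics.QuantumLattice.PatchPairOperator
import HarnessLib

/-!
# Counting the large `d`-wave modes: `#{k : |w_d(k)| ≥ √2/16} ≥ ¾ L² - 4L`

Solo programme `solo-HubbardSuperconductivity-blind`, structural Theorem 22 (part 2: the mode
count; part 1 is `SoloBlindPairCondensate`, part 3 `SoloBlindKinematicFloor` evaluates the floor at
the summit's filling). The `d`-wave profile of the summit's pair field is
`w_d(k) = pairFieldMode dWaveFormFactor L k = 2√2 (cos p₁ - cos p₂)`, `pᵢ = 2π kᵢ / L`
(`pairFieldMode_dWaveFormFactor`). The signed pair condensate of part 1 needs a set `A` of `≍ L²`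
momenta on which `|w_d| ≥ γ` with an `L`-INDEPENDENT `γ > 0`; this file supplies it by
elementary trigonometry and a residue count on `(ℤ/L)²`:

* `abs_dWaveGap_eq` — the product formula `|cos p₁ - cos p₂| = 2 |sin(π r₊/L)| |sin(π r₋/L)|` with
  the RESIDUES `r_± = (k₁ ± k₂ mod L) ∈ {0,…,L-1}` (`cos x - cos y = -2 sin((x+y)/2) sin((x-y)/2)`
  and `π`-periodicity of `|sin|`);
* `two_mul_div_le_sin` — Jordan's inequality on the circle: `R ≤ r`, `r + R ≤ L` ⇒
  `2R/L ≤ sin(π r/L)`;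
* `abs_pairFieldMode_ge_of_good` — hence `|w_d(k)| ≥ 16√2 R²/L²` whenever both residues `r_±(k)`
  lie in `[R, L-R]`;
* `card_filter_residue_le` — for either residue map `k ↦ k₁ ± k₂` and any set `P` of residues,
  `#{k : r_±(k) ∈ P} = … ≤ #P · L` (the map `k ↦ (k₁ ± k₂, k₂)` is injective), and
  `#{a : a.val < R}, #{a : L < a.val + R} ≤ R`; so at most `4RL` momenta are bad;
* `sq_le_card_good_add` — `L² ≤ #{k : |w_d(k)| ≥ √2/16} + 4 (⌊L/16⌋ + 1) L`, i.e. with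
  `R = ⌊L/16⌋ + 1` (so `16R ≥ L`, threshold `16√2R²/L² ≥ √2/16`):
  **`#{k : |w_d(k)| ≥ √2/16} ≥ ¾ L² - 4L`** (`card_good_ge`, real form).

References: D. J. Scalapino, Phys. Rep. 250 (1995) 329, §2 (the `d_{x²-y²}` form factor);
the estimates are elementary. [this work]
-/

noncomputable section

namespace Summit.HubbardSuperconductivity.HubbardSuperconductivity.Theorems.DWaveModeCount

open Finset Real Literature.Probability.LatticeModels Literature.MathematicalPhysics.QuantumLattice

variable {L : ℕ} [NeZero L]

/-! ### Trigonometry of the `d`-wave profile -/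

omit [NeZero L] in
/-- **Jordan's inequality on the circle**: for naturals `R ≤ r` with `r + R ≤ L` (`0 < L`),
`2R/L ≤ sin(π r / L)` (`sin x ≥ (2/π) min(x, π - x)` on `[0, π]`). [folklore] -/
theorem two_mul_div_le_sin {r R : ℕ} (hL : 0 < L) (hRr : R ≤ r) (hrR : r + R ≤ L) :
    2 * (R : ℝ) / L ≤ Real.sin (π * r / L) := by
  have hLpos : (0 : ℝ) < L := by exact_mod_cast hL
  -- the half-circle estimate for a real `0 ≤ y ≤ L/2`
  have hcore : ∀ y : ℝ, 0 ≤ y → 2 * y ≤ L → 2 * y / L ≤ Real.sin (π * y / L) := by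
    intro y hy0 hyL
    have hx1 : π * y / L ≤ π / 2 := by
      rw [div_le_div_iff₀ hLpos two_pos]
      nlinarith [Real.pi_pos]
    have heq : (2 : ℝ) / π * (π * y / L) = 2 * y / L := by
      field_simp
    calc 2 * y / L = 2 / π * (π * y / L) := heq.symm
      _ ≤ Real.sin (π * y / L) := Real.mul_le_sin (by positivity) hx1
  by_cases h2 : 2 * r ≤ L
  · have h2' : (2 : ℝ) * r ≤ L := by exact_mod_cast h2
    have hRr' : (R : ℝ) ≤ r := by exact_mod_cast hRr
    calc 2 * (R : ℝ) / L ≤ 2 * (r : ℝ) / L := by gcongr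
      _ ≤ Real.sin (π * r / L) := hcore r (Nat.cast_nonneg r) h2'
  · have hrL : r ≤ L := by omega
    have h2' : (2 : ℝ) * ((L : ℝ) - r) ≤ L := by
      have : (L : ℝ) < 2 * r := by exact_mod_cast (lt_of_not_ge h2)
      linarith
    have hRr' : (R : ℝ) ≤ (L : ℝ) - r := by
      have : ((r + R : ℕ) : ℝ) ≤ L := by exact_mod_cast hrR
      push_cast at this
      linarith
    have hy0 : (0 : ℝ) ≤ (L : ℝ) - r := by
      have : (r : ℝ) ≤ L := by exact_mod_cast hrL
      linarith
    have hsym : Real.sin (π * r / L) = Real.sin (π * ((L : ℝ) - r) / L) := by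
      rw [← Real.sin_pi_sub (π * ((L : ℝ) - r) / L)]
      congr 1
      field_simp
      ring
    calc 2 * (R : ℝ) / L ≤ 2 * ((L : ℝ) - r) / L := by gcongr
      _ ≤ Real.sin (π * ((L : ℝ) - r) / L) := hcore _ hy0 h2'
      _ = Real.sin (π * r / L) := hsym.symm

/-- `|sin|` only sees the residue: `|sin(π (a.val + b.val)/L)| = |sin(π (a+b).val/L)|`. [folklore] -/
theorem abs_sin_val_add (a b : ZMod L) :
    |Real.sin (π * ((a.val : ℝ) + b.val) / L)| = |Real.sin (π * ((a + b).val : ℝ) / L)| := by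
  have hL : (L : ℝ) ≠ 0 := by exact_mod_cast (NeZero.ne L)
  obtain ⟨q, hq⟩ : ∃ q : ℕ, (a + b).val + L * q = a.val + b.val :=
    ⟨(a.val + b.val) / L, by rw [ZMod.val_add]; exact Nat.mod_add_div _ _⟩
  have hreal : π * ((a.val : ℝ) + b.val) / L = π * ((a + b).val : ℝ) / L + (q : ℝ) * π := by
    have h1 : ((a.val : ℝ) + b.val) = ((a + b).val : ℝ) + (L : ℝ) * (q : ℝ) := by
      exact_mod_cast hq.symm
    rw [h1]
    field_simp
  rw [hreal, Real.sin_add_nat_mul_pi, abs_mul, abs_pow, abs_neg, abs_one, one_pow, one_mul]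

/-- `|sin(π (a.val - b.val)/L)| = |sin(π (a-b).val/L)|`. [folklore] -/
theorem abs_sin_val_sub (a b : ZMod L) :
    |Real.sin (π * ((a.val : ℝ) - b.val) / L)| = |Real.sin (π * ((a - b).val : ℝ) / L)| := by
  have hL : (L : ℝ) ≠ 0 := by exact_mod_cast (NeZero.ne L)
  obtain ⟨q, hq⟩ : ∃ q : ℕ, a.val + L * q = (a - b).val + b.val := by
    refine ⟨((a - b).val + b.val) / L, ?_⟩
    have hval : a.val = ((a - b).val + b.val) % L := by
      conv_lhs => rw [(sub_add_cancel a b).symm]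
      exact ZMod.val_add _ _
    rw [hval]
    exact Nat.mod_add_div _ _
  have hreal : π * ((a.val : ℝ) - b.val) / L = π * ((a - b).val : ℝ) / L - (q : ℝ) * π := by
    have h1 : ((a.val : ℝ) - b.val) = ((a - b).val : ℝ) - (L : ℝ) * (q : ℝ) := by
      have : (a.val : ℝ) + (L : ℝ) * q = ((a - b).val : ℝ) + b.val := by exact_mod_cast hq
      linarith
    rw [h1]
    field_simp
  rw [hreal, Real.sin_sub_nat_mul_pi, abs_mul, abs_pow, abs_neg, abs_one, one_pow, one_mul]

/-- **Product formula with residues**: `|cos p₁ - cos p₂| = 2 |sin(π r₊/L)| |sin(π r₋/L)|`,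
`r_± = (k₁ ± k₂).val`. [folklore] -/
theorem abs_dWaveGap_eq (k : TorusSite 2 L) :
    |dWaveGap k| = 2 * |Real.sin (π * ((k 0 + k 1).val : ℝ) / L)| *
      |Real.sin (π * ((k 0 - k 1).val : ℝ) / L)| := by
  have hL : (L : ℝ) ≠ 0 := by exact_mod_cast (NeZero.ne L)
  unfold dWaveGap latticeMomentum
  rw [Real.cos_sub_cos]
  have h1 : (2 * π * (((k 0).val : ℕ) : ℝ) / L + 2 * π * (((k 1).val : ℕ) : ℝ) / L) / 2 =
      π * (((k 0).val : ℝ) + (k 1).val) / L := by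
    field_simp
  have h2 : (2 * π * (((k 0).val : ℕ) : ℝ) / L - 2 * π * (((k 1).val : ℕ) : ℝ) / L) / 2 =
      π * (((k 0).val : ℝ) - (k 1).val) / L := by
    field_simp
  rw [h1, h2, abs_mul, abs_mul, abs_neg, abs_two, abs_sin_val_add, abs_sin_val_sub]

/-- **The good momenta have a large profile**: if both residues `r_±(k) = (k₁ ± k₂).val` lie in
`[R, L - R]` then `|w_d(k)| ≥ 16√2 R² / L²`. [this work] -/
theorem abs_pairFieldMode_ge_of_good (k : TorusSite 2 L) {R : ℕ} (h1 : R ≤ (k 0 + k 1).val)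
    (h2 : (k 0 + k 1).val + R ≤ L) (h3 : R ≤ (k 0 - k 1).val) (h4 : (k 0 - k 1).val + R ≤ L) :
    16 * Real.sqrt 2 * (R : ℝ) ^ 2 / (L : ℝ) ^ 2 ≤ |pairFieldMode dWaveFormFactor L k| := by
  have hL : 0 < L := Nat.pos_of_ne_zero (NeZero.ne L)
  have ha := two_mul_div_le_sin hL h1 h2
  have hb := two_mul_div_le_sin hL h3 h4
  have h0 : (0 : ℝ) ≤ 2 * (R : ℝ) / L := by positivity
  have ha' : 2 * (R : ℝ) / L ≤ |Real.sin (π * ((k 0 + k 1).val : ℝ) / L)| := ha.trans (le_abs_self _)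
  have hb' : 2 * (R : ℝ) / L ≤ |Real.sin (π * ((k 0 - k 1).val : ℝ) / L)| := hb.trans (le_abs_self _)
  rw [pairFieldMode_dWaveFormFactor, abs_mul, abs_dWaveGap_eq,
    abs_of_pos (by positivity : (0 : ℝ) < 2 * Real.sqrt 2)]
  calc 16 * Real.sqrt 2 * (R : ℝ) ^ 2 / (L : ℝ) ^ 2
      = 2 * Real.sqrt 2 * (2 * (2 * (R : ℝ) / L) * (2 * (R : ℝ) / L)) := by ring
    _ ≤ 2 * Real.sqrt 2 * (2 * |Real.sin (π * ((k 0 + k 1).val : ℝ) / L)| *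
          |Real.sin (π * ((k 0 - k 1).val : ℝ) / L)|) := by gcongr

/-! ### Counting residues -/

/-- Few residues are small: `#{a : a.val < R} ≤ R`. [folklore] -/
theorem card_filter_val_lt_le (R : ℕ) :
    #(Finset.univ.filter fun a : ZMod L => a.val < R) ≤ R := by
  calc #(Finset.univ.filter fun a : ZMod L => a.val < R) ≤ #(Finset.range R) :=
        Finset.card_le_card_of_injOn ZMod.val (fun a ha => by simpa using ha)
          ((ZMod.val_injective L).injOn)
    _ = R := Finset.card_range R

/-- Few residues are large: `#{a : L < a.val + R} ≤ R`. [folklore] -/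
theorem card_filter_lt_val_add_le (R : ℕ) :
    #(Finset.univ.filter fun a : ZMod L => L < a.val + R) ≤ R := by
  calc #(Finset.univ.filter fun a : ZMod L => L < a.val + R) ≤ #(Finset.Ico (L - R) L) := by
        refine Finset.card_le_card_of_injOn ZMod.val (fun a ha => ?_) ((ZMod.val_injective L).injOn)
        have ha' : L < a.val + R := by simpa using ha
        have := ZMod.val_lt a
        simp only [Finset.coe_Ico, Set.mem_Ico]
        omega
    _ = L - (L - R) := Nat.card_Ico _ _
    _ ≤ R := by omega

/-- **Residue classes are evenly covered**: for `g k = k₁ + k₂` or `g k = k₁ - k₂` (any map with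
`k ↦ (g k, k₂)` injective) and any residue set `P`, `#{k : g k ∈ P} ≤ #P · L`. [folklore] -/
theorem card_filter_residue_le (g : TorusSite 2 L → ZMod L)
    (hg : ∀ k k' : TorusSite 2 L, g k = g k' → k 1 = k' 1 → k = k') (P : Finset (ZMod L)) :
    #(Finset.univ.filter fun k : TorusSite 2 L => g k ∈ P) ≤ #P * L := by
  classical
  calc #(Finset.univ.filter fun k : TorusSite 2 L => g k ∈ P) ≤ #(P ×ˢ (Finset.univ : Finset (ZMod L))) := by
        refine Finset.card_le_card_of_injOn (fun k => (g k, k 1)) (fun k hk => ?_) ?_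
        · have hk' : g k ∈ P := by simpa using hk
          simp [hk']
        · intro k _ k' _ h
          simp only [Prod.mk.injEq] at h
          exact hg k k' h.1 h.2
    _ = #P * L := by rw [Finset.card_product, Finset.card_univ, ZMod.card]

omit [NeZero L] in
/-- `k ↦ (k₁ + k₂, k₂)` is injective. [folklore] -/
theorem eq_of_add_eq (k k' : TorusSite 2 L) (h : k 0 + k 1 = k' 0 + k' 1) (h1 : k 1 = k' 1) :
    k = k' := by
  have h0 : k 0 = k' 0 := by rw [h1] at h; exact add_right_cancel h
  funext i; fin_cases i <;> assumption

omit [NeZero L] in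
/-- `k ↦ (k₁ - k₂, k₂)` is injective. [folklore] -/
theorem eq_of_sub_eq (k k' : TorusSite 2 L) (h : k 0 - k 1 = k' 0 - k' 1) (h1 : k 1 = k' 1) :
    k = k' := by
  have h0 : k 0 = k' 0 := by rw [h1] at h; exact sub_left_injective h
  funext i; fin_cases i <;> assumption

/-! ### The count -/

/-- **At most `4RL` momenta are bad, and the good ones have `|w_d| ≥ √2/16`**: with
`R = ⌊L/16⌋ + 1`, `L² ≤ #{k : √2/16 ≤ |w_d(k)|} + 4RL`. [this work] -/
theorem sq_le_card_good_add :
    L ^ 2 ≤ #(Finset.univ.filter fun k : TorusSite 2 L =>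
        Real.sqrt 2 / 16 ≤ |pairFieldMode dWaveFormFactor L k|) + 4 * (L / 16 + 1) * L := by
  classical
  set R : ℕ := L / 16 + 1 with hR
  have hL : 0 < L := Nat.pos_of_ne_zero (NeZero.ne L)
  have h16 : L < 16 * R := Nat.lt_mul_div_succ L (by norm_num)
  -- the four bad pieces
  set B₁ := Finset.univ.filter fun k : TorusSite 2 L => (k 0 + k 1).val < R with hB₁
  set B₂ := Finset.univ.filter fun k : TorusSite 2 L => L < (k 0 + k 1).val + R with hB₂
  set B₃ := Finset.univ.filter fun k : TorusSite 2 L => (k 0 - k 1).val < R with hB₃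
  set B₄ := Finset.univ.filter fun k : TorusSite 2 L => L < (k 0 - k 1).val + R with hB₄
  set G := Finset.univ.filter fun k : TorusSite 2 L =>
    Real.sqrt 2 / 16 ≤ |pairFieldMode dWaveFormFactor L k| with hG
  have hc₁ : #B₁ ≤ R * L := by
    have := card_filter_residue_le (fun k : TorusSite 2 L => k 0 + k 1) eq_of_add_eq
      (Finset.univ.filter fun a : ZMod L => a.val < R)
    simp only [Finset.mem_filter, Finset.mem_univ, true_and] at this
    exact this.trans (Nat.mul_le_mul_right _ (card_filter_val_lt_le R))
  have hc₂ : #B₂ ≤ R * L := by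
    have := card_filter_residue_le (fun k : TorusSite 2 L => k 0 + k 1) eq_of_add_eq
      (Finset.univ.filter fun a : ZMod L => L < a.val + R)
    simp only [Finset.mem_filter, Finset.mem_univ, true_and] at this
    exact this.trans (Nat.mul_le_mul_right _ (card_filter_lt_val_add_le R))
  have hc₃ : #B₃ ≤ R * L := by
    have := card_filter_residue_le (fun k : TorusSite 2 L => k 0 - k 1) eq_of_sub_eq
      (Finset.univ.filter fun a : ZMod L => a.val < R)
    simp only [Finset.mem_filter, Finset.mem_univ, true_and] at this
    exact this.trans (Nat.mul_le_mul_right _ (card_filter_val_lt_le R))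
  have hc₄ : #B₄ ≤ R * L := by
    have := card_filter_residue_le (fun k : TorusSite 2 L => k 0 - k 1) eq_of_sub_eq
      (Finset.univ.filter fun a : ZMod L => L < a.val + R)
    simp only [Finset.mem_filter, Finset.mem_univ, true_and] at this
    exact this.trans (Nat.mul_le_mul_right _ (card_filter_lt_val_add_le R))
  -- good momenta: outside the four pieces the profile is large
  have hthr : Real.sqrt 2 / 16 ≤ 16 * Real.sqrt 2 * (R : ℝ) ^ 2 / (L : ℝ) ^ 2 := by
    have hLr : (0 : ℝ) < L := by exact_mod_cast hL
    have h16r : (L : ℝ) ≤ 16 * R := by exact_mod_cast h16.le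
    rw [div_le_div_iff₀ (by norm_num : (0 : ℝ) < 16) (by positivity)]
    have hs : 0 < Real.sqrt 2 := by positivity
    nlinarith [mul_le_mul h16r h16r hLr.le (by positivity : (0 : ℝ) ≤ 16 * R)]
  have hcover : Finset.univ ⊆ G ∪ (B₁ ∪ B₂ ∪ B₃ ∪ B₄) := by
    intro k _
    by_contra hk
    simp only [hG, hB₁, hB₂, hB₃, hB₄, Finset.mem_union, Finset.mem_filter, Finset.mem_univ,
      true_and, not_or, not_le, not_lt] at hk
    obtain ⟨hg, ⟨⟨h1, h2⟩, h3⟩, h4⟩ := hk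
    exact (lt_irrefl _) (hg.trans_le' (hthr.trans (abs_pairFieldMode_ge_of_good k h1 h2 h3 h4)))
  have hcardU : #(Finset.univ : Finset (TorusSite 2 L)) = L ^ 2 := by
    rw [Finset.card_univ]; simp [ZMod.card]
  calc L ^ 2 = #(Finset.univ : Finset (TorusSite 2 L)) := hcardU.symm
    _ ≤ #(G ∪ (B₁ ∪ B₂ ∪ B₃ ∪ B₄)) := Finset.card_le_card hcover
    _ ≤ #G + #(B₁ ∪ B₂ ∪ B₃ ∪ B₄) := Finset.card_union_le _ _
    _ ≤ #G + (#B₁ + #B₂ + #B₃ + #B₄) := by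
        gcongr
        calc #(B₁ ∪ B₂ ∪ B₃ ∪ B₄) ≤ #(B₁ ∪ B₂ ∪ B₃) + #B₄ := Finset.card_union_le _ _
          _ ≤ #(B₁ ∪ B₂) + #B₃ + #B₄ := by gcongr; exact Finset.card_union_le _ _
          _ ≤ #B₁ + #B₂ + #B₃ + #B₄ := by gcongr; exact Finset.card_union_le _ _
    _ ≤ #G + 4 * R * L := by
        have : #B₁ + #B₂ + #B₃ + #B₄ ≤ 4 * R * L := by
          calc #B₁ + #B₂ + #B₃ + #B₄ ≤ R * L + R * L + R * L + R * L := by gcongr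
            _ = 4 * R * L := by ring
        omega

/-- **Theorem 22 (mode count): `#{k : |w_d(k)| ≥ √2/16} ≥ ¾ L² - 4 L`.** [this work] -/
theorem card_good_ge :
    3 / 4 * (L : ℝ) ^ 2 - 4 * L ≤ (#(Finset.univ.filter fun k : TorusSite 2 L =>
        Real.sqrt 2 / 16 ≤ |pairFieldMode dWaveFormFactor L k|) : ℝ) := by
  have h := sq_le_card_good_add (L := L)
  have hR : ((L / 16 : ℕ) : ℝ) ≤ (L : ℝ) / 16 := Nat.cast_div_le
  have h' : ((L ^ 2 : ℕ) : ℝ) ≤ (#(Finset.univ.filter fun k : TorusSite 2 L =>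
        Real.sqrt 2 / 16 ≤ |pairFieldMode dWaveFormFactor L k|) : ℝ) +
      4 * (((L / 16 : ℕ) : ℝ) + 1) * L := by exact_mod_cast h
  push_cast at h'
  have hL : (0 : ℝ) ≤ L := Nat.cast_nonneg L
  nlinarith [mul_le_mul_of_nonneg_right hR hL]

end Summit.HubbardSuperconductivity.HubbardSuperconductivity.Theorems.DWaveModeCount
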